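import Summits.CriticalPhenomena.PercolationContinuityZ3.Theorems.Transplant.HexShadowGammaMin
import HarnessLib

/-!
# HEXAGONAL SHADOWS XIX — the planar crossing fact for `𝕋`-shadows via the ×2 SUBDIVISION EMBEDDING of the triangular lattice into `ℤ²`

builds on p205010 (kernel theorem, internal audit signed; external expert review pending) — NOT used in this file.
Lane `prim-bschramm`, seat `prim-bschramm-p2` (gen 32; class C1b; memo `HOME/bschramm/P2-LATTICES.md` §116–§117); helper file
(`--supports stmt-CriticalPhenomena-4575 --as helper`).

WHY.  Fact 1 of DST §2.3 rests on "projections of paths … must intersect": two lattice walks of `ℤ²` that cross topologically share a VERTEX (the tree's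
`exists_mem_support_of_crossing` / `exists_mem_support_of_side_crossing`, `PlanarDuality` / `SlabGluing`, by winding numbers).  The shadows of our paths
are walks of the TRIANGULAR lattice `𝕋` (steps `±e₀, ±e₁, ±(e₀ − e₁)`, or no move).  Rather than redoing the winding-number theory for `𝕋`, we embed:
`z ↦ 2z`, an axis step `↦` two unit steps through the midpoint, the diagonal `z → z + (1,−1)` `↦` the staircase `2z, 2z+(1,0), 2z+(1,−1), 2z+(2,−1), 2z+(2,−2)`
(R, D, R, D).  The images are nearest-neighbour walks of `ℤ²`, and — the point of the construction — the images of two `𝕋`-edges share a lattice point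
ONLY IF the edges share an endpoint (`Seg2.common`: a case analysis on the parities of the common point).  So a common vertex of the image walks yields a
common `𝕋`-vertex of the shadows, and the `ℤ²` crossing lemma transfers.
* §1 `dbl`, the support predicate `Seg2 z z' x` (the image points of the pair `z, z'`, `triNorm (z' − z) ≤ 1`), **`Seg2.common`**, coordinate bounds;
* §2 `exists_walk_seg2` (the image walk of one step), **`exists_dblWalk_of_chain`** (the image walk of a `triNorm`-1-Lipschitz chain, e.g. the shadow of an
  open path of a `HexShadow`), **`exists_dblWalk_in_hexBall`** (a route between two points of a lattice hexagon through its centre, inside it).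
[cite: DuminilCopinSidoraviciusTassion2016, §2.3 (proof of Fact 1: "must intersect")] [cite: GrimmettPercolation1999, §1.6 p. 16]
-/

noncomputable section

namespace Summit.CriticalPhenomena.PercolationContinuityZ3.Theorems.Transplant

open MeasureTheory Literature.Probability.Percolation Literature.Probability.LatticeModels SimpleGraph Filter
open scoped Classical Topology

/-! ## §1 The subdivision embedding: image points of a `𝕋`-step -/

/-- The doubling map `z ↦ 2z` of `ℤ²`. [folklore] -/
def dbl (z : Site 2) : Site 2 := ![2 * z 0, 2 * z 1]

/-- Coordinates of `dbl`. [folklore] -/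
@[simp] theorem dbl_apply_zero (z : Site 2) : dbl z 0 = 2 * z 0 := rfl

/-- Coordinates of `dbl`. [folklore] -/
@[simp] theorem dbl_apply_one (z : Site 2) : dbl z 1 = 2 * z 1 := rfl

/-- **The image points of the pair `(z, z')`** under the subdivision embedding (a flat disjunction in coordinates): the doubled endpoints, the midpoint of
a doubled axis step, the three inner points of the staircase of a doubled diagonal step. [folklore] -/
def Seg2 (z z' x : Site 2) : Prop :=
  (x 0 = 2 * z 0 ∧ x 1 = 2 * z 1) ∨ (x 0 = 2 * z' 0 ∧ x 1 = 2 * z' 1) ∨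
  (z' 0 = z 0 + 1 ∧ z' 1 = z 1 ∧ x 0 = 2 * z 0 + 1 ∧ x 1 = 2 * z 1) ∨
  (z 0 = z' 0 + 1 ∧ z 1 = z' 1 ∧ x 0 = 2 * z' 0 + 1 ∧ x 1 = 2 * z' 1) ∨
  (z' 1 = z 1 + 1 ∧ z' 0 = z 0 ∧ x 0 = 2 * z 0 ∧ x 1 = 2 * z 1 + 1) ∨
  (z 1 = z' 1 + 1 ∧ z 0 = z' 0 ∧ x 0 = 2 * z' 0 ∧ x 1 = 2 * z' 1 + 1) ∨
  (z' 0 = z 0 + 1 ∧ z' 1 = z 1 - 1 ∧ x 0 = 2 * z 0 + 1 ∧ x 1 = 2 * z 1) ∨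
  (z' 0 = z 0 + 1 ∧ z' 1 = z 1 - 1 ∧ x 0 = 2 * z 0 + 1 ∧ x 1 = 2 * z 1 - 1) ∨
  (z' 0 = z 0 + 1 ∧ z' 1 = z 1 - 1 ∧ x 0 = 2 * z 0 + 2 ∧ x 1 = 2 * z 1 - 1) ∨
  (z 0 = z' 0 + 1 ∧ z 1 = z' 1 - 1 ∧ x 0 = 2 * z' 0 + 1 ∧ x 1 = 2 * z' 1) ∨
  (z 0 = z' 0 + 1 ∧ z 1 = z' 1 - 1 ∧ x 0 = 2 * z' 0 + 1 ∧ x 1 = 2 * z' 1 - 1) ∨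
  (z 0 = z' 0 + 1 ∧ z 1 = z' 1 - 1 ∧ x 0 = 2 * z' 0 + 2 ∧ x 1 = 2 * z' 1 - 1)

namespace Seg2

/-- `Seg2` is symmetric in the pair. [folklore] -/
theorem symm {z z' x : Site 2} (h : Seg2 z z' x) : Seg2 z' z x := by
  unfold Seg2 at h ⊢
  rcases h with h | h | h | h | h | h | h | h | h | h | h | h <;>
    first
    | exact Or.inl h
    | exact Or.inr (Or.inl h)
    | exact Or.inr (Or.inr (Or.inl h))
    | exact Or.inr (Or.inr (Or.inr (Or.inl h)))
    | exact Or.inr (Or.inr (Or.inr (Or.inr (Or.inl h))))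
    | exact Or.inr (Or.inr (Or.inr (Or.inr (Or.inr (Or.inl h)))))
    | exact Or.inr (Or.inr (Or.inr (Or.inr (Or.inr (Or.inr (Or.inl h))))))
    | exact Or.inr (Or.inr (Or.inr (Or.inr (Or.inr (Or.inr (Or.inr (Or.inl h)))))))
    | exact Or.inr (Or.inr (Or.inr (Or.inr (Or.inr (Or.inr (Or.inr (Or.inr (Or.inl h))))))))
    | exact Or.inr (Or.inr (Or.inr (Or.inr (Or.inr (Or.inr (Or.inr (Or.inr (Or.inr (Or.inl h)))))))))
    | exact Or.inr (Or.inr (Or.inr (Or.inr (Or.inr (Or.inr (Or.inr (Or.inr (Or.inr (Or.inr (Or.inl h))))))))))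
    | exact Or.inr (Or.inr (Or.inr (Or.inr (Or.inr (Or.inr (Or.inr (Or.inr (Or.inr (Or.inr (Or.inr h))))))))))

/-- The doubled first point is an image point. [folklore] -/
theorem left (z z' : Site 2) : Seg2 z z' (dbl z) := Or.inl ⟨rfl, rfl⟩

/-- The doubled second point is an image point. [folklore] -/
theorem right (z z' : Site 2) : Seg2 z z' (dbl z') := Or.inr (Or.inl ⟨rfl, rfl⟩)

/-- **THE EMBEDDING RESPECTS INCIDENCES**: if the images of the pairs `(z, z')` and `(y, y')` share a point then the pairs share a point.
[folklore] -/
theorem common {z z' y y' x : Site 2} (h1 : Seg2 z z' x) (h2 : Seg2 y y' x) : ∃ p : Site 2, (p = z ∨ p = z') ∧ (p = y ∨ p = y') := by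
  have key : (z 0 = y 0 ∧ z 1 = y 1) ∨ (z 0 = y' 0 ∧ z 1 = y' 1) ∨ (z' 0 = y 0 ∧ z' 1 = y 1) ∨ (z' 0 = y' 0 ∧ z' 1 = y' 1) := by
    unfold Seg2 at h1 h2
    rcases h1 with h1 | h1 | h1 | h1 | h1 | h1 | h1 | h1 | h1 | h1 | h1 | h1 <;>
      rcases h2 with h2 | h2 | h2 | h2 | h2 | h2 | h2 | h2 | h2 | h2 | h2 | h2 <;> omega
  rcases key with h | h | h | h
  · exact ⟨z, Or.inl rfl, Or.inl (Site.eq_iff_two.2 h)⟩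
  · exact ⟨z, Or.inl rfl, Or.inr (Site.eq_iff_two.2 h)⟩
  · exact ⟨z', Or.inr rfl, Or.inl (Site.eq_iff_two.2 h)⟩
  · exact ⟨z', Or.inr rfl, Or.inr (Site.eq_iff_two.2 h)⟩

/-- Coordinate bounds of the image points: coordinate `0`. [folklore] -/
theorem bound₀ {z z' x : Site 2} (h : Seg2 z z' x) {lo hi : ℤ} (h1 : lo ≤ z 0) (h2 : lo ≤ z' 0) (h3 : z 0 ≤ hi) (h4 : z' 0 ≤ hi) :
    2 * lo ≤ x 0 ∧ x 0 ≤ 2 * hi := by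
  unfold Seg2 at h
  rcases h with h | h | h | h | h | h | h | h | h | h | h | h <;> omega

/-- Coordinate bounds of the image points: coordinate `1`. [folklore] -/
theorem bound₁ {z z' x : Site 2} (h : Seg2 z z' x) {lo hi : ℤ} (h1 : lo ≤ z 1) (h2 : lo ≤ z' 1) (h3 : z 1 ≤ hi) (h4 : z' 1 ≤ hi) :
    2 * lo ≤ x 1 ∧ x 1 ≤ 2 * hi := by
  unfold Seg2 at h
  rcases h with h | h | h | h | h | h | h | h | h | h | h | h <;> omega

end Seg2

/-! ## §2 Image walks -/

/-- A unit step of `ℤ²` from its coordinate description. [folklore] -/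
private theorem adj_of_coords {x y : Site 2}
    (h : (y 0 = x 0 + 1 ∧ y 1 = x 1) ∨ (x 0 = y 0 + 1 ∧ y 1 = x 1) ∨ (y 1 = x 1 + 1 ∧ y 0 = x 0) ∨ (x 1 = y 1 + 1 ∧ y 0 = x 0)) :
    (zdGraph 2).Adj x y := (zdGraph_two_adj_iff x y).2 h

/-- The image walk of a pair `(z, z')` in the four "forward" configurations `z' − z ∈ {0, e₀, e₁, e₀ − e₁}`. [folklore] -/
private theorem exists_walk_seg2_fwd {z z' : Site 2}
    (h : (z' 0 = z 0 ∧ z' 1 = z 1) ∨ (z' 0 = z 0 + 1 ∧ z' 1 = z 1) ∨ (z' 1 = z 1 + 1 ∧ z' 0 = z 0) ∨ (z' 0 = z 0 + 1 ∧ z' 1 = z 1 - 1)) :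
    ∃ W : (zdGraph 2).Walk (dbl z) (dbl z'), ∀ x ∈ W.support, Seg2 z z' x := by
  rcases h with ⟨h0, h1⟩ | ⟨h0, h1⟩ | ⟨h1, h0⟩ | ⟨h0, h1⟩
  · -- no move
    have e : dbl z' = dbl z := Site.eq_iff_two.2 ⟨by simp [h0], by simp [h1]⟩
    refine ⟨Walk.nil.copy rfl e.symm, fun x hx => ?_⟩
    rw [Walk.support_copy, Walk.support_nil, List.mem_singleton] at hx
    subst hx; exact Seg2.left z z'
  · -- `e₀`: two steps to the right
    set q : Site 2 := ![2 * z 0 + 1, 2 * z 1] with hq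
    have a1 : (zdGraph 2).Adj (dbl z) q := adj_of_coords (Or.inl ⟨by simp [hq], by simp [hq]⟩)
    have a2 : (zdGraph 2).Adj q (dbl z') := adj_of_coords (Or.inl ⟨by simp [hq, h0]; ring, by simp [hq, h1]⟩)
    refine ⟨Walk.cons a1 (Walk.cons a2 Walk.nil), fun x hx => ?_⟩
    simp only [Walk.support_cons, Walk.support_nil, List.mem_cons, List.not_mem_nil, or_false] at hx
    rcases hx with rfl | rfl | rfl
    · exact Seg2.left z z'
    · unfold Seg2; simp [hq]; omega
    · exact Seg2.right z z'
  · -- `e₁`: two steps up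
    set q : Site 2 := ![2 * z 0, 2 * z 1 + 1] with hq
    have a1 : (zdGraph 2).Adj (dbl z) q := adj_of_coords (Or.inr (Or.inr (Or.inl ⟨by simp [hq], by simp [hq]⟩)))
    have a2 : (zdGraph 2).Adj q (dbl z') := adj_of_coords (Or.inr (Or.inr (Or.inl ⟨by simp [hq, h1]; ring, by simp [hq, h0]⟩)))
    refine ⟨Walk.cons a1 (Walk.cons a2 Walk.nil), fun x hx => ?_⟩
    simp only [Walk.support_cons, Walk.support_nil, List.mem_cons, List.not_mem_nil, or_false] at hx
    rcases hx with rfl | rfl | rfl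
    · exact Seg2.left z z'
    · unfold Seg2; simp [hq]; omega
    · exact Seg2.right z z'
  · -- the diagonal `e₀ − e₁`: the staircase R, D, R, D
    set q₁ : Site 2 := ![2 * z 0 + 1, 2 * z 1] with hq₁
    set q₂ : Site 2 := ![2 * z 0 + 1, 2 * z 1 - 1] with hq₂
    set q₃ : Site 2 := ![2 * z 0 + 2, 2 * z 1 - 1] with hq₃
    have a1 : (zdGraph 2).Adj (dbl z) q₁ := adj_of_coords (Or.inl ⟨by simp [hq₁], by simp [hq₁]⟩)
    have a2 : (zdGraph 2).Adj q₁ q₂ := adj_of_coords (Or.inr (Or.inr (Or.inr ⟨by simp [hq₁, hq₂], by simp [hq₁, hq₂]⟩)))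
    have a3 : (zdGraph 2).Adj q₂ q₃ := adj_of_coords (Or.inl ⟨by simp [hq₂, hq₃]; ring, by simp [hq₂, hq₃]⟩)
    have a4 : (zdGraph 2).Adj q₃ (dbl z') := adj_of_coords (Or.inr (Or.inr (Or.inr ⟨by simp [hq₃, h1]; ring, by simp [hq₃, h0]; ring⟩)))
    refine ⟨Walk.cons a1 (Walk.cons a2 (Walk.cons a3 (Walk.cons a4 Walk.nil))), fun x hx => ?_⟩
    simp only [Walk.support_cons, Walk.support_nil, List.mem_cons, List.not_mem_nil, or_false] at hx
    rcases hx with rfl | rfl | rfl | rfl | rfl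
    · exact Seg2.left z z'
    · unfold Seg2; simp [hq₁]; omega
    · unfold Seg2; simp [hq₂]; omega
    · unfold Seg2; simp [hq₃]; omega
    · exact Seg2.right z z'

/-- **The image walk of one `𝕋`-step (or no move)**: for `triNorm (z' − z) ≤ 1` a walk of `ℤ²` from `2z` to `2z'` through image points of the pair.
[folklore] -/
theorem exists_walk_seg2 {z z' : Site 2} (h : triNorm (z' - z) ≤ 1) : ∃ W : (zdGraph 2).Walk (dbl z) (dbl z'), ∀ x ∈ W.support, Seg2 z z' x := by
  have hcases : ((z' 0 = z 0 ∧ z' 1 = z 1) ∨ (z' 0 = z 0 + 1 ∧ z' 1 = z 1) ∨ (z' 1 = z 1 + 1 ∧ z' 0 = z 0) ∨ (z' 0 = z 0 + 1 ∧ z' 1 = z 1 - 1)) ∨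
      ((z 0 = z' 0 ∧ z 1 = z' 1) ∨ (z 0 = z' 0 + 1 ∧ z 1 = z' 1) ∨ (z 1 = z' 1 + 1 ∧ z 0 = z' 0) ∨ (z 0 = z' 0 + 1 ∧ z 1 = z' 1 - 1)) := by
    simp only [triNorm, Pi.sub_apply, max_le_iff, abs_le] at h
    omega
  rcases hcases with hf | hb
  · exact exists_walk_seg2_fwd hf
  · obtain ⟨W, hW⟩ := exists_walk_seg2_fwd hb
    refine ⟨W.reverse, fun x hx => ?_⟩
    rw [Walk.support_reverse, List.mem_reverse] at hx
    exact (hW x hx).symm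

/-- **The image walk of a `triNorm`-1-Lipschitz chain** (the shadow of an open path of a graph with a hexagonal shadow): a walk of `ℤ²` from the double of
the first shadow to the double of the last, every vertex of which is an image point of a pair of shadows of (consecutive) chain elements. [folklore] -/
theorem exists_dblWalk_of_chain {α : Type*} (f : α → Site 2) :
    ∀ (a : α) (l : List α), (a :: l).IsChain (fun u v => triNorm (f v - f u) ≤ 1) →
      ∃ (e : α) (W : (zdGraph 2).Walk (dbl (f a)) (dbl (f e))), (a :: l).getLast (List.cons_ne_nil a l) = e ∧
        ∀ x ∈ W.support, ∃ u ∈ a :: l, ∃ v ∈ a :: l, Seg2 (f u) (f v) x := by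
  intro a l
  induction l generalizing a with
  | nil =>
    intro _
    refine ⟨a, Walk.nil, rfl, fun x hx => ⟨a, by simp, a, by simp, ?_⟩⟩
    rw [Walk.support_nil, List.mem_singleton] at hx
    subst hx; exact Seg2.left _ _
  | cons b l ih =>
    intro hc
    rw [List.isChain_cons_cons] at hc
    obtain ⟨e, W, he, hW⟩ := ih b hc.2
    obtain ⟨W₁, hW₁⟩ := exists_walk_seg2 hc.1
    have hlast : (a :: b :: l).getLast (List.cons_ne_nil a (b :: l)) = e := by
      rw [List.getLast_cons (List.cons_ne_nil b l)]; exact he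
    refine ⟨e, W₁.append W, hlast, fun x hx => ?_⟩
    rw [Walk.mem_support_append_iff] at hx
    rcases hx with hx | hx
    · exact ⟨a, by simp, b, by simp, hW₁ x hx⟩
    · obtain ⟨u, hu, v, hv, h⟩ := hW x hx
      exact ⟨u, by simp [hu], v, by simp [hv], h⟩

/-- The lattice segment from `c + (a, b)` towards the axis along `e₀`: all points `c + (t, b)` with `t` between `0` and `a` lie in `hexBall c r` if
`c + (a, b)` does. [folklore] -/
private theorem mem_hexBall_of_between {c : Site 2} {r : ℕ} {a b t : ℤ} (h : (c + ![a, b] : Site 2) ∈ hexBall c r)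
    (ht : (0 ≤ t ∧ t ≤ a) ∨ (a ≤ t ∧ t ≤ 0)) : (c + ![t, b] : Site 2) ∈ hexBall c r := by
  rw [mem_hexBall, add_sub_cancel_left] at h ⊢
  simp only [triNorm, Matrix.cons_val_zero, Matrix.cons_val_one, max_le_iff, abs_le] at h ⊢
  omega

/-- The same along `e₁`: `c + (0, t)` with `t` between `0` and `b`. [folklore] -/
private theorem mem_hexBall_of_between' {c : Site 2} {r : ℕ} {b t : ℤ} (h : (c + ![0, b] : Site 2) ∈ hexBall c r)
    (ht : (0 ≤ t ∧ t ≤ b) ∨ (b ≤ t ∧ t ≤ 0)) : (c + ![0, t] : Site 2) ∈ hexBall c r := by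
  rw [mem_hexBall, add_sub_cancel_left] at h ⊢
  simp only [triNorm, Matrix.cons_val_zero, Matrix.cons_val_one, max_le_iff, abs_le] at h ⊢
  omega

/-- A straight route: the doubled walk from `c + (a, b)` to `c + (a', b)` along `e₀` (`n = |a − a'|` steps), through image points of pairs of points
`c + (t, b)` with `t` between `a` and `a'`. [folklore] -/
private theorem exists_dblWalk_horiz (c : Site 2) (b : ℤ) : ∀ (n : ℕ) (a : ℤ),
    ∃ W : (zdGraph 2).Walk (dbl (c + ![a, b])) (dbl (c + ![a + n, b])),
      ∀ x ∈ W.support, ∃ t t' : ℤ, a ≤ t ∧ t ≤ a + n ∧ a ≤ t' ∧ t' ≤ a + n ∧ Seg2 (c + ![t, b]) (c + ![t', b]) x := by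
  intro n
  induction n with
  | zero =>
    intro a
    refine ⟨Walk.nil.copy rfl (by simp), fun x hx => ⟨a, a, le_rfl, by simp, le_rfl, by simp, ?_⟩⟩
    rw [Walk.support_copy, Walk.support_nil, List.mem_singleton] at hx
    subst hx; exact Seg2.left _ _
  | succ n ih =>
    intro a
    obtain ⟨W, hW⟩ := ih (a + 1)
    have hstep : triNorm ((c + ![a + 1, b] : Site 2) - (c + ![a, b])) ≤ 1 := by
      rw [show (c + ![a + 1, b] : Site 2) - (c + ![a, b]) = ![a + 1, b] - ![a, b] by abel]
      simp [triNorm]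
    obtain ⟨W₁, hW₁⟩ := exists_walk_seg2 hstep
    refine ⟨W₁.append (W.copy rfl (by push_cast; ring_nf)), fun x hx => ?_⟩
    rw [Walk.mem_support_append_iff, Walk.support_copy] at hx
    rcases hx with hx | hx
    · exact ⟨a, a + 1, le_rfl, by push_cast; omega, by omega, by push_cast; omega, hW₁ x hx⟩
    · obtain ⟨t, t', h1, h2, h3, h4, h5⟩ := hW x hx
      exact ⟨t, t', by omega, by push_cast at h2 ⊢; omega, by omega, by push_cast at h4 ⊢; omega, h5⟩

/-- The same along `e₁`. [folklore] -/
private theorem exists_dblWalk_vert (c : Site 2) (a : ℤ) : ∀ (n : ℕ) (b : ℤ),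
    ∃ W : (zdGraph 2).Walk (dbl (c + ![a, b])) (dbl (c + ![a, b + n])),
      ∀ x ∈ W.support, ∃ t t' : ℤ, b ≤ t ∧ t ≤ b + n ∧ b ≤ t' ∧ t' ≤ b + n ∧ Seg2 (c + ![a, t]) (c + ![a, t']) x := by
  intro n
  induction n with
  | zero =>
    intro b
    refine ⟨Walk.nil.copy rfl (by simp), fun x hx => ⟨b, b, le_rfl, by simp, le_rfl, by simp, ?_⟩⟩
    rw [Walk.support_copy, Walk.support_nil, List.mem_singleton] at hx
    subst hx; exact Seg2.left _ _
  | succ n ih =>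
    intro b
    obtain ⟨W, hW⟩ := ih (b + 1)
    have hstep : triNorm ((c + ![a, b + 1] : Site 2) - (c + ![a, b])) ≤ 1 := by
      rw [show (c + ![a, b + 1] : Site 2) - (c + ![a, b]) = ![a, b + 1] - ![a, b] by abel]
      simp [triNorm]
    obtain ⟨W₁, hW₁⟩ := exists_walk_seg2 hstep
    refine ⟨W₁.append (W.copy rfl (by push_cast; ring_nf)), fun x hx => ?_⟩
    rw [Walk.mem_support_append_iff, Walk.support_copy] at hx
    rcases hx with hx | hx
    · exact ⟨b, b + 1, le_rfl, by push_cast; omega, by omega, by push_cast; omega, hW₁ x hx⟩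
    · obtain ⟨t, t', h1, h2, h3, h4, h5⟩ := hW x hx
      exact ⟨t, t', by omega, by push_cast at h2 ⊢; omega, by omega, by push_cast at h4 ⊢; omega, h5⟩

/-- The doubled route from a point of a lattice hexagon to its centre, inside the hexagon: first along `e₀` to the axis `{w₀ = c₀}`, then along `e₁`.
[folklore] -/
theorem exists_dblWalk_to_centre {c : Site 2} {r : ℕ} {z : Site 2} (hz : z ∈ hexBall c r) :
    ∃ W : (zdGraph 2).Walk (dbl z) (dbl c), ∀ x ∈ W.support, ∃ q ∈ hexBall c r, ∃ q' ∈ hexBall c r, Seg2 q q' x := by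
  -- coordinates
  set a : ℤ := z 0 - c 0 with ha
  set b : ℤ := z 1 - c 1 with hb
  have hz' : z = c + ![a, b] := by ext j; fin_cases j <;> simp [ha, hb]
  have hmid : (c + ![0, b] : Site 2) ∈ hexBall c r := mem_hexBall_of_between (hz' ▸ hz) (by omega)
  have hc0 : (c + ![0, 0] : Site 2) = c := by ext j; fin_cases j <;> simp
  -- horizontal leg between `c + (a, b)` and `c + (0, b)`
  have hH : ∃ W : (zdGraph 2).Walk (dbl (c + ![a, b])) (dbl (c + ![0, b])), ∀ x ∈ W.support, ∃ q ∈ hexBall c r, ∃ q' ∈ hexBall c r, Seg2 q q' x := by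
    rcases le_or_gt 0 a with h0a | h0a
    · obtain ⟨W, hW⟩ := exists_dblWalk_horiz c b a.toNat 0
      have e1 : (c + ![(0 : ℤ) + (a.toNat : ℕ), b] : Site 2) = c + ![a, b] := by rw [Int.toNat_of_nonneg h0a]; simp
      refine ⟨(W.copy (by simp) (by rw [e1])).reverse, fun x hx => ?_⟩
      rw [Walk.support_reverse, List.mem_reverse, Walk.support_copy] at hx
      obtain ⟨t, t', h1, h2, h3, h4, h5⟩ := hW x hx
      rw [Int.toNat_of_nonneg h0a] at h2 h4
      exact ⟨_, mem_hexBall_of_between (hz' ▸ hz) (by omega), _, mem_hexBall_of_between (hz' ▸ hz) (by omega), h5⟩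
    · obtain ⟨W, hW⟩ := exists_dblWalk_horiz c b (-a).toNat a
      have e1 : (c + ![a + ((-a).toNat : ℕ), b] : Site 2) = c + ![0, b] := by rw [Int.toNat_of_nonneg (by omega)]; simp
      refine ⟨W.copy rfl (by rw [e1]), fun x hx => ?_⟩
      rw [Walk.support_copy] at hx
      obtain ⟨t, t', h1, h2, h3, h4, h5⟩ := hW x hx
      rw [Int.toNat_of_nonneg (by omega)] at h2 h4
      exact ⟨_, mem_hexBall_of_between (hz' ▸ hz) (by omega), _, mem_hexBall_of_between (hz' ▸ hz) (by omega), h5⟩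
  -- vertical leg between `c + (0, b)` and `c`
  have hV : ∃ W : (zdGraph 2).Walk (dbl (c + ![0, b])) (dbl c), ∀ x ∈ W.support, ∃ q ∈ hexBall c r, ∃ q' ∈ hexBall c r, Seg2 q q' x := by
    rcases le_or_gt 0 b with h0b | h0b
    · obtain ⟨W, hW⟩ := exists_dblWalk_vert c 0 b.toNat 0
      have e1 : (c + ![(0 : ℤ), 0 + (b.toNat : ℕ)] : Site 2) = c + ![0, b] := by rw [Int.toNat_of_nonneg h0b]; simp
      refine ⟨(W.copy (by rw [hc0]) (by rw [e1])).reverse, fun x hx => ?_⟩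
      rw [Walk.support_reverse, List.mem_reverse, Walk.support_copy] at hx
      obtain ⟨t, t', h1, h2, h3, h4, h5⟩ := hW x hx
      rw [Int.toNat_of_nonneg h0b] at h2 h4
      exact ⟨_, mem_hexBall_of_between' hmid (by omega), _, mem_hexBall_of_between' hmid (by omega), h5⟩
    · obtain ⟨W, hW⟩ := exists_dblWalk_vert c 0 (-b).toNat b
      have e1 : (c + ![(0 : ℤ), b + ((-b).toNat : ℕ)] : Site 2) = c := by
        rw [Int.toNat_of_nonneg (by omega)]; ext j; fin_cases j <;> simp
      refine ⟨W.copy rfl (by rw [e1]), fun x hx => ?_⟩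
      rw [Walk.support_copy] at hx
      obtain ⟨t, t', h1, h2, h3, h4, h5⟩ := hW x hx
      rw [Int.toNat_of_nonneg (by omega)] at h2 h4
      exact ⟨_, mem_hexBall_of_between' hmid (by omega), _, mem_hexBall_of_between' hmid (by omega), h5⟩
  obtain ⟨W₁, hW₁⟩ := hH
  obtain ⟨W₂, hW₂⟩ := hV
  refine ⟨(W₁.copy (by rw [hz']) rfl).append W₂, fun x hx => ?_⟩
  rw [Walk.mem_support_append_iff, Walk.support_copy] at hx
  rcases hx with hx | hx
  · exact hW₁ x hx
  · exact hW₂ x hx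

/-- **A doubled route between two points of a lattice hexagon, inside it** (through the centre). [folklore] -/
theorem exists_dblWalk_in_hexBall {c : Site 2} {r : ℕ} {z w : Site 2} (hz : z ∈ hexBall c r) (hw : w ∈ hexBall c r) :
    ∃ W : (zdGraph 2).Walk (dbl z) (dbl w), ∀ x ∈ W.support, ∃ q ∈ hexBall c r, ∃ q' ∈ hexBall c r, Seg2 q q' x := by
  obtain ⟨W₁, hW₁⟩ := exists_dblWalk_to_centre hz
  obtain ⟨W₂, hW₂⟩ := exists_dblWalk_to_centre hw
  refine ⟨W₁.append W₂.reverse, fun x hx => ?_⟩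
  rw [Walk.mem_support_append_iff, Walk.support_reverse, List.mem_reverse] at hx
  rcases hx with hx | hx
  · exact hW₁ x hx
  · exact hW₂ x hx

end Summit.CriticalPhenomena.PercolationContinuityZ3.Theorems.Transplant

end
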